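import Summits.QuantumFields.YangMills.Theorems.BalabanUVNodesN22AtRecordOfOutputCoordHoloPrinted
import Summits.QuantumFields.YangMills.Theorems.BalabanUVNodesN22AtRecordOfPrintedSlotsClosed
import Summits.QuantumFields.YangMills.Theorems.BalabanUVNodesN22KernelLimitOfRealTwoPointRecord

/-!
# NODE N22 (NE9) ∕ (D4) — THE PRINT-LEVEL EDITION WITH THE (1.21) EXISTENCE LETTER DISCHARGED ON THE CHART-FREE ROAD: `h9` ∕ `hdec` and the N22 ∕ (D4) pin faces AT THE RECORD from
# OUTPUT-level coupling holomorphy of the (2.13) terms ([I] p. 266) ∕ printed (1.18) `TermBound118` + PRINTED (2.38) + PRINTED `AnalyticH` + holomorphic readings + tails + the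
# small∕near class + the REAL-PROBE cross-volume law (G≈ℝ) — the «(G≈ℝ)-keyed» edition of `…N22AtRecordOfOutputCoordHoloPrinted`

Cell `pub-ymgap`, Track A (HUMAN RULING D-0062), WIDTH SEAT `dag-n22-w3` g5 on node n22 = NE9; `--kind proof --supports stmt-QuantumFields-27366 --as helper` (KEY MAP v2: K3⁸
`SpineGivenEndpointR13SepCoPHV`), COUNT-NEUTRAL; THEOREMS ONLY (0 `def`, 0 `sorry`, standard axioms).  The open one-liner of this seat's g4 ■ («the (G≈ℝ)-keyed editions of n22-w5's
printed-slot ∕ output-level … record files») and of dag-n22-w5 g0′'s HANDOFF («NOT mine: n22-w3 g4 (G≈ℝ) real two-point law files»).  dag-n22-w5's (G≈)-keyed print-level edition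
`…N22AtRecordOfOutputCoordHoloPrintedTwoPointGenerating` (p622968) discharges the ONE non-print ∕ non-structural input of `…N22AtRecordOfOutputCoordHoloPrinted` (p621851), the (1.21)
existence letter `PolLimitsExistOfRecord₁₃ F N θ`, through the complex bidisc law (G≈) (this seat's g4, p616912 §3); THIS FILE discharges it instead through g4's CHART-FREE law (G≈ℝ)
(`polLimitsExistOfRecord₁₃_of_realTwoPoint`, p620925 §5): «the small-domain partial sums of the FINITE-VOLUME (2.13) terms at Bałaban's own REAL probe families
`emb_K(exp θ.ρ8(a·e_{μ,z,c} + b·e_{ν,0,c}))`, `|a|, |b| ≤ r₂`, are `C r₀^K`-close across consecutive volumes» — [I] p. 264 «Now we take a limit of these functions as T^{(j+1)} ↗ Z^d»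
verbatim in type, NO complexification in the hypothesis (the complex bound the Cauchy step needs is DERIVED from `Bound238` + the torus count inside p619896; the price is the dial pair
`(r₀, s)` with the rate numeral `ρ_s < 1`, satisfiable for every family by g4's `exists_realTwoPoint_dials`).  One application each of p621851's four margin ∕ `TermBound118` faces, `hHhol`
per prefix from PRINTED `AnalyticH` + holomorphic readings via J32′ §1 exactly as in p622968; nothing of p616135 ∕ `…OutputValue` ∕ p621851 ∕ p620925 ∕ p607522 ∕ J30 ∕ J32′ is re-declared.

WHAT.  ★★★ `ne9_EA_objectsOfRecord₁₃_of_outputCoordHolo_analyticH_realTwoPoint` ∕ ★★★ `n22At_rateCarriers_of_kernels_pin_of_outputCoordHolo_analyticH_realTwoPoint` (§2b's `h9` and the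
N22 pin face ∀ k) and ★★★ `kernelDecayOfRecord₁₃_of_termBound118_analyticH_realTwoPoint` ∕ ★★★ `readOutAt_rateCarriers_of_kernels_pin_of_termBound118_analyticH_realTwoPoint` (`hdec` at any
`κ′ ≤ δ₁` and the (D4) pin face ∀ k), from: W1-20's law `Localizes17OfRecord₁₃ F N θ S emb`; OUTPUT-level coupling holomorphy of the terms on uniform margins `ρt` in EVERY coupling
(resp. printed (1.18) `TermBound118 (S K) (Window θ.γ) (spj K) B κ_E`); PRINTED (2.38) `Bound238` and PRINTED `AnalyticH` on the boxes; Road 1's numerals in p607522's strength; HOLOMORPHIC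
complexified probe readings `Φ` of the record's β-chart with the chart clause and this seat's space clause (still needed by the tails and the Cauchy step, NOT by the law); site weights
with the minimizer tails, `δ₀ > 0`; the small∕near class `lo` with its threshold clause; the probe radius `0 < r₂`, `(2B₃+1)(2r₂) ≤ r`; the dials `0 < r₀ ≤ 1`, `0 < s < 1`, `ρ_s < 1`;
(G≈ℝ) at rate `r₀` (VERBATIM from p620925); a dominating letter block.  NO (1.21)-existence hypothesis, NO term-holomorphy hypothesis, NO kernel-level letter, NO complex-probe law is
displayed.  THE N22 ∕ (D4) ROW SENTENCES, PRINT + (G≈ℝ): «W1-20's law + [I] p. 266 coupling analyticity on uniform margins (resp. printed (1.18)) + printed (2.38) + printed configuration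
analyticity + holomorphic minimizer readings + p. 282 tails + (G≈ℝ) at the real probe families + dials + numerals + a dominating letter block ⇒ `h9` ∕ `hdec` ∕ the pin faces at the
pinned bundle, every run length».

HONEST FRAMING (binding).  Count-neutral COMPOSITION of landed theorems by name; NO estimate of Bałaban's is proved or asserted; every displayed input is a HYPOTHESIS with its
owner (output-level coupling margins: N10 ∕ NODE A older, N09 last — the uniform margin is the cell's QUANTIFIED reading of [I] p. 263 ∕ p. 266, NOT a printed estimate; printed
(2.38) ∕ `AnalyticH` ∕ (1.18): N10 ∕ NODE A; readings + tails: NODE A ∕ N09; (G≈ℝ): NODE A ∕ def-W1 — the thermodynamic convergence near the window of the finite-volume local terms,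
NOT typed here; law: NODE A ∕ N10 ∕ def-W1); (1.21) for the terms OF RECORD is NOT thereby proved — it is REDUCED; nothing of the record is constructed or claimed to meet the
hypotheses; N22 and (D4) are NOT discharged (typed 28∕28 · discharged 5∕27 UNCHANGED); K3⁸ OPEN and NOT claimed, no stub touched; NE9 is NOT IN PRINT for d = 4; no count claim (the
chair's single count line is the only count); no summit statement is proved by this seat; one finite 𝕋⁴ programme at fixed ε — R4 closes the CONDITIONAL rung `BalabanLadder.UV` only;
NOTHING about the continuum limit, ℝ⁴, infinite volume, OS axioms, a mass gap or the Clay problem is proved or claimed by any of this.  A5∕A6: p620925's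
`polLimitsExist_localizedSum_of_realTwoPoint_fires_zeroTower` + J34 `outputCoordLetters_termlessStep` + `analyticH_termlessStep` inhabit the non-record hypotheses at the EMPTY towers
(DEGENERATE, declared; this seat's g5 `…N22KernelLimitOfNestedTermsModel` is the NON-degenerate model inhabitant of the existence SCHEMAS underneath, not of these record-level faces);
the law, (G≈ℝ)'s subject at the record, `θ` and the reading OF RECORD are LOCATED hypotheses.  References (TYPES only, no cite tags on the Summit side): [I] = Bałaban, CMP 109 (1987)
(1.7) p. 261, §1 p. 263, §2 p. 266, (1.18) p. 263, (1.20)–(1.21) p. 264, p. 282, (5.10) p. 293; [II] = CMP 116 (1988) (1.26) p. 8, (2.13)–(2.14) pp. 14–15, (2.38) p. 20, (2.41) p. 21.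
-/

noncomputable section

open Filter Topology Metric Set
open scoped BigOperators

namespace YMDAG.N22.AtRecordOfPrintedSlots

open Literature.MathematicalPhysics.QuantumFieldTheory.Balaban1983to89
open Literature.MathematicalPhysics.QuantumFieldTheory.Balaban1983to89.T4Continuum (T4Family ULoop)
open Literature.MathematicalPhysics.QuantumFieldTheory.Balaban1983to89.T4OutputRate (Window NE9)
open Literature.MathematicalPhysics.QuantumFieldTheory.Balaban1983to89.Node00 (polScalar siteOfInt Stage13Params Stage13HParams U3Letters₁₁ MatA datumOfRecord₁₃CoPH)
open Literature.MathematicalPhysics.QuantumFieldTheory.Balaban1983to89.Node00.Sect2 (domCount domSys CPair)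
open Literature.MathematicalPhysics.QuantumFieldTheory.Balaban1983to89.Node00.LocalizedSum17 (ReadingMaps Localizes17OfRecord₁₃)
open Literature.MathematicalPhysics.QuantumFieldTheory.Balaban1983to89.Node00.W1 (ClusterTower ClusterStep TermBound118 box)
open Literature.MathematicalPhysics.QuantumFieldTheory.Balaban1983to89.Node00.U3OfKernels (histPrefix objectsOfRecord₁₃ KernelDecayOfRecord₁₃)
open Literature.MathematicalPhysics.QuantumFieldTheory.Balaban1983to89.Node00.U3KernelLetters (PolLimitsExistOfRecord₁₃)
open Literature.MathematicalPhysics.QuantumFieldTheory.Balaban1983to89.B12Decay510 (delta1)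
open Literature.MathematicalPhysics.QuantumFieldTheory.Balaban1983to89.B12Decay510Window (K₁)
open Literature.MathematicalPhysics.QuantumFieldTheory.Balaban1983to89.B12Decay510Torus (distCT nearT)
open Literature.MathematicalPhysics.QuantumFieldTheory.Balaban1983to89.B12TreeDecay (K₀ kappa₀)
open Literature.MathematicalPhysics.QuantumFieldTheory.Balaban1983to89.TreeLengthTorus (TPt torusTreeLen)
open Literature.MathematicalPhysics.QuantumFieldTheory.Balaban1983to89.B12Sec2to5 (betaPrime510)
open YMDAG.UVSplit (N22At ReadOutAt RateReading₁₃CoPH rateCarriersOfRecord₁₃CoPH)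
open YMDAG.N22.WindowedOfCouplingHolo (differentiableOn_H_comp_of_analyticH histPrefix_mem_box)
open YMDAG.N22.AtKernels (polLimitsExistOfRecord₁₃_of_realTwoPoint)

open scoped Matrix.Norms.L2Operator

variable (F : T4Family) (N : ℕ) [NeZero N]

/-! ## §1 `h9` and the N22 pin face: output-level coupling holomorphy + print's slots + (G≈ℝ) -/

open Classical in
/-- ★★★ **K3⁸ §2b's `h9` FROM OUTPUT-LEVEL COUPLING HOLOMORPHY IN EVERY COUPLING + PRINTED (2.38) + PRINTED `AnalyticH` + (G≈ℝ)**, (1.21)-existence DISCHARGED ON THE CHART-FREE ROAD: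
p621851 §1 `ne9_EA_objectsOfRecord₁₃_of_outputCoordHolo_analyticH` with `hlim := polLimitsExistOfRecord₁₃_of_realTwoPoint …` (p620925 §5; its `hHhol` from the SAME PRINTED `AnalyticH` +
the SAME holomorphic readings by J32′ §1; numerals in p607522's strength): law + one holomorphy datum `hL` per `(K, k, i)` on uniform margins `ρt (k+1) i` + `Bound238` ∕ `AnalyticH` on the
boxes + numerals + holomorphic readings with chart∕space clauses + tails + the small∕near class `lo` + probe radius `(2B₃+1)(2r₂) ≤ r` + dials `(r₀, s)`, `ρ_s < 1` + (G≈ℝ) at the real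
probe families + a dominating letter block ⟹ `NE9 ((objectsOfRecord₁₃ F N θ ℓ).EA 0) (Window θ.γ) ℓ.κ ℓ.moduli`.  LOCATED (hypothesis form); N22 NOT discharged. -/
theorem ne9_EA_objectsOfRecord₁₃_of_outputCoordHolo_analyticH_realTwoPoint (θ : Stage13Params F N) (ℓ : U3Letters₁₁) (hs : ℓ.Signs)
    {𝔸 : Type*} [NormedRing 𝔸] [NormedAlgebra ℂ 𝔸] (m' : ℕ) (M : ℕ) [NeZero M] (hM : M = F.L ^ m')
    (S : (K : ℕ) → ClusterTower (F.P K) 𝔸 M) (emb : ReadingMaps F (MatA N) 𝔸) (hloc : Localizes17OfRecord₁₃ F N θ S emb)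
    (sp : (K k : ℕ) → (domSys (F.P K) M (k + 1)).Dom → Set (CPair (F.P K) 𝔸))
    {A R r₁ κ κE δ₀ B₃ r B r₂ r₀ s : ℝ} (ρt : ℕ → ℕ → ℝ) (hρt : ∀ n i, 0 < ρt n i)
    (hA : 0 ≤ A) (hr₁ : 0 ≤ r₁) (hrate : r₁ + 2 * (64 * Real.log 162) + 2 ≤ R) (hsmall : A * Real.exp (5 * r₁ + 1) * K₀ 64 8 * 9 * 64 ≤ 1)
    (hκ0 : 0 < κ) (hκr : κ ≤ r₁) (hκ4 : kappa₀ (4 * 2 ^ 4) (2 * 4) ≤ κ / 2 / 2) (hδ₀ : 0 < δ₀) (hB₃ : 0 ≤ B₃) (hr : 0 < r) (hB : 0 ≤ B) (hκE : κ ≤ κE)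
    (hL : ∀ (K k : ℕ) (i : Fin (k + 1)), ∀ g ∈ box θ.γ k, ∀ (X : (domSys (F.P K) M (k + 1)).Dom), ∀ φ ∈ sp K k X,
      ∃ (Ec : ℂ → ℂ) (O : Set ℂ), DifferentiableOn ℂ Ec O ∧ (∀ t ∈ Ioc (0 : ℝ) θ.γ, closedBall (t : ℂ) (ρt (k + 1) i) ⊆ O) ∧
        (∀ z ∈ O, ‖Ec z‖ ≤ B * Real.exp (-(κE * (domSys (F.P K) M (k + 1)).dj X))) ∧
        (∀ t ∈ Ioc (0 : ℝ) θ.γ, Ec t = ((S K) k).E (Function.update g i t) φ X))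
    (h238 : ∀ K k, ((S K) k).Bound238 (box θ.γ k) (sp K k) A R) (hAn : ∀ K k, ((S K) k).AnalyticH (box θ.γ k) (sp K k))
    (Ec : ℕ → ℕ → Type*) [∀ K k, NormedAddCommGroup (Ec K k)] [∀ K k, NormedSpace ℂ (Ec K k)]
    (ι : letI := θ.instVβ₁; letI := θ.instVβ₂
      (K k : ℕ) → (domSys (F.P K) M (k + 1)).Dom → ((Fin (F.P K).d → Site (F.P K) (k + 1) → θ.Vβ) →L[ℝ] Ec K k))
    (Φ : (K k : ℕ) → (domSys (F.P K) M (k + 1)).Dom → Ec K k → CPair (F.P K) 𝔸)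
    (U : (K k : ℕ) → (domSys (F.P K) M (k + 1)).Dom → Set (Ec K k)) (hU : ∀ K k X, IsOpen (U K k X)) (hrU : ∀ K k X, ball (0 : Ec K k) r ⊆ U K k X)
    (hΦhol : ∀ (K k : ℕ) (X : (domSys (F.P K) M (k + 1)).Dom), DifferentiableOn ℂ (Φ K k X) (U K k X))
    (hΦemb : letI := θ.instVβ₁; letI := θ.instVβ₂
      ∀ (K k : ℕ) (X : (domSys (F.P K) M (k + 1)).Dom) (B : Fin (F.P K).d → Site (F.P K) (k + 1) → θ.Vβ),
        Φ K k X (ι K k X B) = emb K k (fun l t => NormedSpace.exp (θ.ρ8 (B l t))))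
    (hΦsp : ∀ (K k : ℕ) (X : (domSys (F.P K) M (k + 1)).Dom), ∀ z ∈ U K k X, ∀ Z : (domSys (F.P K) M (k + 1)).Dom, Z.1 ⊆ X.1 → Φ K k X z ∈ sp K k Z)
    (w : (K k : ℕ) → (domSys (F.P K) M (k + 1)).Dom → Site (F.P K) (k + 1) → ℝ) (hw₀ : ∀ K k X t, 0 ≤ w K k X t)
    (hw : letI := θ.instVβ₁; letI := θ.instVβ₂; letI := θ.instιβ
      ∀ (K k : ℕ) (X : (domSys (F.P K) M (k + 1)).Dom) (l : Fin (F.P K).d) (t : Site (F.P K) (k + 1)) (c : θ.ιβ),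
        ‖ι K k X (Pi.single l (Pi.single t (θ.bV c)))‖ ≤ w K k X t)
    (htail : ∀ (K k : ℕ) (X : (domSys (F.P K) M (k + 1)).Dom) (t : Site (F.P K) (k + 1)),
      let e : Site (F.P K) (k + 1) → TPt 4 (domCount (F.P K) M (k + 1) * M) := fun x i => (ZMod.cast (x i) : ZMod (domCount (F.P K) M (k + 1) * M))
      w K k X t ≤ B₃ * Real.exp (-δ₀ * distCT (domCount (F.P K) M (k + 1)) M (e t) (nearT (M := M) (e t) X)))
    (lo : (k K : ℕ) → (domSys (F.P K) M (k + 1)).Dom → Prop) [∀ k K, DecidablePred (lo k K)]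
    (hlo : ∀ (k K : ℕ) (X : (domSys (F.P K) M (k + 1)).Dom), ¬ lo k K X →
      let e : Site (F.P K) (k + 1) → TPt 4 (domCount (F.P K) M (k + 1) * M) := fun x i => (ZMod.cast (x i) : ZMod (domCount (F.P K) M (k + 1) * M))
      (K : ℝ) ≤ torusTreeLen X.1 ∨ (K : ℝ) ≤ distCT (domCount (F.P K) M (k + 1)) M (e (siteOfInt F K (k + 1) 0)) (nearT (M := M) (e (siteOfInt F K (k + 1) 0)) X))
    (hr₂ : 0 < r₂) (hr₂r : (2 * B₃ + 1) * (2 * r₂) ≤ r) (hs0 : 0 < s) (hs1 : s < 1) (hr₀pos : 0 < r₀) (hr₀1 : r₀ ≤ 1)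
    (hρ : (r₀ ^ (1 - s) * ((F.L : ℝ) ^ 4) ^ s) ^ (1 - s) * ((F.L : ℝ) ^ 4) ^ s < 1)
    (hGR : letI := θ.instVβ₁; letI := θ.instVβ₂; letI := θ.instιβ
      ∀ g ∈ Window θ.γ, ∀ (k : ℕ) (μ ν : Fin 4) (z : Fin 4 → ℤ), ∃ (K₀ : ℕ) (C : ℝ), ∀ K : ℕ, K₀ ≤ K → ∀ (c : θ.ιβ) (a b : ℝ), |a| ≤ r₂ → |b| ≤ r₂ →
      ‖∑ X ∈ Finset.univ.filter (lo k (K + 1)), ((S (K + 1)) k).E (histPrefix g k) (emb (K + 1) k (fun l t => NormedSpace.exp (θ.ρ8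
          ((a • (Pi.single (Fin.cast (F.P_d (K + 1)).symm μ) (Pi.single (siteOfInt F (K + 1) (k + 1) z) (θ.bV c)) : Fin (F.P (K + 1)).d → Site (F.P (K + 1)) (k + 1) → θ.Vβ) +
            b • (Pi.single (Fin.cast (F.P_d (K + 1)).symm ν) (Pi.single (siteOfInt F (K + 1) (k + 1) 0) (θ.bV c)) : Fin (F.P (K + 1)).d → Site (F.P (K + 1)) (k + 1) → θ.Vβ)) l t)))) X -
        ∑ X ∈ Finset.univ.filter (lo k K), ((S K) k).E (histPrefix g k) (emb K k (fun l t => NormedSpace.exp (θ.ρ8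
          ((a • (Pi.single (Fin.cast (F.P_d K).symm μ) (Pi.single (siteOfInt F K (k + 1) z) (θ.bV c)) : Fin (F.P K).d → Site (F.P K) (k + 1) → θ.Vβ) +
            b • (Pi.single (Fin.cast (F.P_d K).symm ν) (Pi.single (siteOfInt F K (k + 1) 0) (θ.bV c)) : Fin (F.P K).d → Site (F.P K) (k + 1) → θ.Vβ)) l t)))) X‖ ≤ C * r₀ ^ K)
    (hℓκ : ℓ.κ ≤ delta1 δ₀ κ ((M : ℝ) * 4))
    (hdom : ∀ n i, 16 * B₃ ^ 2 / r ^ 2 * Real.exp (delta1 δ₀ κ ((M : ℝ) * 4) * ((M : ℝ) * 4) * 3) * K₀ (4 * 2 ^ 4) (2 * 4) * K₁ 4 (δ₀ / 2) *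
        (4 * B / ρt n i) ≤ ℓ.moduli n i) :
    NE9 ((objectsOfRecord₁₃ F N θ ℓ).EA 0) (Window θ.γ) ℓ.κ ℓ.moduli :=
  ne9_EA_objectsOfRecord₁₃_of_outputCoordHolo F N θ ℓ hs (polLimitsExistOfRecord₁₃_of_realTwoPoint F N θ m' hM S emb hloc (fun _ k => box θ.γ k) (fun _ hg _ k => histPrefix_mem_box hg k) sp hA hr₁ hκ0 hκr hκ4 hrate hsmall hB₃ hδ₀ hr h238 Ec ι Φ U hU hrU
      (fun K k _ hh X Z hZ => differentiableOn_H_comp_of_analyticH ((S K) k) (box θ.γ k) (sp K k) (hAn K k) hh (Φ K k X) (hΦhol K k X) X (hΦsp K k X) Z hZ)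
      hΦemb hΦsp w hw₀ hw htail lo hlo hr₂ hr₂r hs0 hs1 hr₀pos hr₀1 hρ hGR) m' M hM S emb hloc sp ρt hρt (kappa₀_le_half_of_le_quarter hκ0 hκ4) hδ₀ hB₃ hr hB hκE hL Ec ι Φ U hU hrU
    (differentiableOn_E_comp_of_printedSlots F S sp hA hr₁ hrate hsmall h238 hAn Ec Φ U hU hΦhol hΦsp)
    hΦemb (ball_mem_sp_of_spaceClause F sp Ec Φ U hrU hΦsp) w hw₀ hw htail hℓκ hdom

open Classical in
/-- ★★★ **THE N22 PIN FACE IN PRINT-LEVEL CURRENCY, (1.21) DISCHARGED FROM THE ACTIVITY SLOTS + (G≈ℝ)** — `N22At (rateCarriersOfRecord₁₃CoPH 𝔯 F θ hP g₀ os k).u3` for EVERY `k` under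
`hpin`: p621851 §1 `n22At_rateCarriers_of_kernels_pin_of_outputCoordHolo_analyticH` with `hlim := polLimitsExistOfRecord₁₃_of_realTwoPoint …` (p620925 §5).  «W1-20's law + [I] p. 266 coupling
analyticity of the terms on uniform margins + printed (2.38) + printed configuration analyticity + holomorphic minimizer readings + p. 282 tails + (G≈ℝ) + dials + numerals + a dominating
letter block ⇒ `N22At` at the pinned bundle, every run length».  LOCATED (hypothesis form); N22 NOT discharged. -/
theorem n22At_rateCarriers_of_kernels_pin_of_outputCoordHolo_analyticH_realTwoPoint (𝔯 : RateReading₁₃CoPH N) (θ : Stage13HParams F N) (hP : θ.Provisos₁₃CoPH F N)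
    (g₀ : ℕ → ℝ) (os : List (ULoop F)) (ℓ : U3Letters₁₁) (hs : ℓ.Signs) (hpin : (𝔯.lit F θ hP g₀ os).u3 = objectsOfRecord₁₃ F N θ.toStage13Params ℓ)
    {𝔸 : Type*} [NormedRing 𝔸] [NormedAlgebra ℂ 𝔸] (m' : ℕ) (M : ℕ) [NeZero M] (hM : M = F.L ^ m')
    (S : (K : ℕ) → ClusterTower (F.P K) 𝔸 M) (emb : ReadingMaps F (MatA N) 𝔸) (hloc : Localizes17OfRecord₁₃ F N θ.toStage13Params S emb)
    (sp : (K k : ℕ) → (domSys (F.P K) M (k + 1)).Dom → Set (CPair (F.P K) 𝔸))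
    {A R r₁ κ κE δ₀ B₃ r B r₂ r₀ s : ℝ} (ρt : ℕ → ℕ → ℝ) (hρt : ∀ n i, 0 < ρt n i)
    (hA : 0 ≤ A) (hr₁ : 0 ≤ r₁) (hrate : r₁ + 2 * (64 * Real.log 162) + 2 ≤ R) (hsmall : A * Real.exp (5 * r₁ + 1) * K₀ 64 8 * 9 * 64 ≤ 1)
    (hκ0 : 0 < κ) (hκr : κ ≤ r₁) (hκ4 : kappa₀ (4 * 2 ^ 4) (2 * 4) ≤ κ / 2 / 2) (hδ₀ : 0 < δ₀) (hB₃ : 0 ≤ B₃) (hr : 0 < r) (hB : 0 ≤ B) (hκE : κ ≤ κE)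
    (hL : ∀ (K k : ℕ) (i : Fin (k + 1)), ∀ g ∈ box θ.γ k, ∀ (X : (domSys (F.P K) M (k + 1)).Dom), ∀ φ ∈ sp K k X,
      ∃ (Ec : ℂ → ℂ) (O : Set ℂ), DifferentiableOn ℂ Ec O ∧ (∀ t ∈ Ioc (0 : ℝ) θ.γ, closedBall (t : ℂ) (ρt (k + 1) i) ⊆ O) ∧
        (∀ z ∈ O, ‖Ec z‖ ≤ B * Real.exp (-(κE * (domSys (F.P K) M (k + 1)).dj X))) ∧
        (∀ t ∈ Ioc (0 : ℝ) θ.γ, Ec t = ((S K) k).E (Function.update g i t) φ X))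
    (h238 : ∀ K k, ((S K) k).Bound238 (box θ.γ k) (sp K k) A R) (hAn : ∀ K k, ((S K) k).AnalyticH (box θ.γ k) (sp K k))
    (Ec : ℕ → ℕ → Type*) [∀ K k, NormedAddCommGroup (Ec K k)] [∀ K k, NormedSpace ℂ (Ec K k)]
    (ι : letI := θ.instVβ₁; letI := θ.instVβ₂
      (K k : ℕ) → (domSys (F.P K) M (k + 1)).Dom → ((Fin (F.P K).d → Site (F.P K) (k + 1) → θ.Vβ) →L[ℝ] Ec K k))
    (Φ : (K k : ℕ) → (domSys (F.P K) M (k + 1)).Dom → Ec K k → CPair (F.P K) 𝔸)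
    (U : (K k : ℕ) → (domSys (F.P K) M (k + 1)).Dom → Set (Ec K k)) (hU : ∀ K k X, IsOpen (U K k X)) (hrU : ∀ K k X, ball (0 : Ec K k) r ⊆ U K k X)
    (hΦhol : ∀ (K k : ℕ) (X : (domSys (F.P K) M (k + 1)).Dom), DifferentiableOn ℂ (Φ K k X) (U K k X))
    (hΦemb : letI := θ.instVβ₁; letI := θ.instVβ₂
      ∀ (K k : ℕ) (X : (domSys (F.P K) M (k + 1)).Dom) (B : Fin (F.P K).d → Site (F.P K) (k + 1) → θ.Vβ),
        Φ K k X (ι K k X B) = emb K k (fun l t => NormedSpace.exp (θ.ρ8 (B l t))))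
    (hΦsp : ∀ (K k : ℕ) (X : (domSys (F.P K) M (k + 1)).Dom), ∀ z ∈ U K k X, ∀ Z : (domSys (F.P K) M (k + 1)).Dom, Z.1 ⊆ X.1 → Φ K k X z ∈ sp K k Z)
    (w : (K k : ℕ) → (domSys (F.P K) M (k + 1)).Dom → Site (F.P K) (k + 1) → ℝ) (hw₀ : ∀ K k X t, 0 ≤ w K k X t)
    (hw : letI := θ.instVβ₁; letI := θ.instVβ₂; letI := θ.instιβ
      ∀ (K k : ℕ) (X : (domSys (F.P K) M (k + 1)).Dom) (l : Fin (F.P K).d) (t : Site (F.P K) (k + 1)) (c : θ.ιβ),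
        ‖ι K k X (Pi.single l (Pi.single t (θ.bV c)))‖ ≤ w K k X t)
    (htail : ∀ (K k : ℕ) (X : (domSys (F.P K) M (k + 1)).Dom) (t : Site (F.P K) (k + 1)),
      let e : Site (F.P K) (k + 1) → TPt 4 (domCount (F.P K) M (k + 1) * M) := fun x i => (ZMod.cast (x i) : ZMod (domCount (F.P K) M (k + 1) * M))
      w K k X t ≤ B₃ * Real.exp (-δ₀ * distCT (domCount (F.P K) M (k + 1)) M (e t) (nearT (M := M) (e t) X)))
    (lo : (k K : ℕ) → (domSys (F.P K) M (k + 1)).Dom → Prop) [∀ k K, DecidablePred (lo k K)]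
    (hlo : ∀ (k K : ℕ) (X : (domSys (F.P K) M (k + 1)).Dom), ¬ lo k K X →
      let e : Site (F.P K) (k + 1) → TPt 4 (domCount (F.P K) M (k + 1) * M) := fun x i => (ZMod.cast (x i) : ZMod (domCount (F.P K) M (k + 1) * M))
      (K : ℝ) ≤ torusTreeLen X.1 ∨ (K : ℝ) ≤ distCT (domCount (F.P K) M (k + 1)) M (e (siteOfInt F K (k + 1) 0)) (nearT (M := M) (e (siteOfInt F K (k + 1) 0)) X))
    (hr₂ : 0 < r₂) (hr₂r : (2 * B₃ + 1) * (2 * r₂) ≤ r) (hs0 : 0 < s) (hs1 : s < 1) (hr₀pos : 0 < r₀) (hr₀1 : r₀ ≤ 1)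
    (hρ : (r₀ ^ (1 - s) * ((F.L : ℝ) ^ 4) ^ s) ^ (1 - s) * ((F.L : ℝ) ^ 4) ^ s < 1)
    (hGR : letI := θ.instVβ₁; letI := θ.instVβ₂; letI := θ.instιβ
      ∀ g ∈ Window θ.γ, ∀ (k : ℕ) (μ ν : Fin 4) (z : Fin 4 → ℤ), ∃ (K₀ : ℕ) (C : ℝ), ∀ K : ℕ, K₀ ≤ K → ∀ (c : θ.ιβ) (a b : ℝ), |a| ≤ r₂ → |b| ≤ r₂ →
      ‖∑ X ∈ Finset.univ.filter (lo k (K + 1)), ((S (K + 1)) k).E (histPrefix g k) (emb (K + 1) k (fun l t => NormedSpace.exp (θ.ρ8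
          ((a • (Pi.single (Fin.cast (F.P_d (K + 1)).symm μ) (Pi.single (siteOfInt F (K + 1) (k + 1) z) (θ.bV c)) : Fin (F.P (K + 1)).d → Site (F.P (K + 1)) (k + 1) → θ.Vβ) +
            b • (Pi.single (Fin.cast (F.P_d (K + 1)).symm ν) (Pi.single (siteOfInt F (K + 1) (k + 1) 0) (θ.bV c)) : Fin (F.P (K + 1)).d → Site (F.P (K + 1)) (k + 1) → θ.Vβ)) l t)))) X -
        ∑ X ∈ Finset.univ.filter (lo k K), ((S K) k).E (histPrefix g k) (emb K k (fun l t => NormedSpace.exp (θ.ρ8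
          ((a • (Pi.single (Fin.cast (F.P_d K).symm μ) (Pi.single (siteOfInt F K (k + 1) z) (θ.bV c)) : Fin (F.P K).d → Site (F.P K) (k + 1) → θ.Vβ) +
            b • (Pi.single (Fin.cast (F.P_d K).symm ν) (Pi.single (siteOfInt F K (k + 1) 0) (θ.bV c)) : Fin (F.P K).d → Site (F.P K) (k + 1) → θ.Vβ)) l t)))) X‖ ≤ C * r₀ ^ K)
    (hℓκ : ℓ.κ ≤ delta1 δ₀ κ ((M : ℝ) * 4))
    (hdom : ∀ n i, 16 * B₃ ^ 2 / r ^ 2 * Real.exp (delta1 δ₀ κ ((M : ℝ) * 4) * ((M : ℝ) * 4) * 3) * K₀ (4 * 2 ^ 4) (2 * 4) * K₁ 4 (δ₀ / 2) *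
        (4 * B / ρt n i) ≤ ℓ.moduli n i) (k : ℕ) :
    N22At (rateCarriersOfRecord₁₃CoPH 𝔯 F θ hP g₀ os k).u3 :=
  n22At_rateCarriers_of_kernels_pin_of_outputCoordHolo F N 𝔯 θ hP g₀ os ℓ hs hpin (polLimitsExistOfRecord₁₃_of_realTwoPoint F N θ.toStage13Params m' hM S emb hloc (fun _ k => box θ.γ k) (fun _ hg _ k => histPrefix_mem_box hg k) sp hA hr₁ hκ0 hκr hκ4 hrate hsmall hB₃ hδ₀ hr h238 Ec ι Φ U hU hrU
      (fun K k _ hh X Z hZ => differentiableOn_H_comp_of_analyticH ((S K) k) (box θ.γ k) (sp K k) (hAn K k) hh (Φ K k X) (hΦhol K k X) X (hΦsp K k X) Z hZ)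
      hΦemb hΦsp w hw₀ hw htail lo hlo hr₂ hr₂r hs0 hs1 hr₀pos hr₀1 hρ hGR) m' M hM S emb hloc sp ρt hρt (kappa₀_le_half_of_le_quarter hκ0 hκ4) hδ₀ hB₃ hr hB hκE hL Ec ι Φ U hU hrU
    (differentiableOn_E_comp_of_printedSlots F S sp hA hr₁ hrate hsmall h238 hAn Ec Φ U hU hΦhol hΦsp)
    hΦemb (ball_mem_sp_of_spaceClause F sp Ec Φ U hrU hΦsp) w hw₀ hw htail hℓκ hdom k

/-! ## §2 `hdec` and the (D4) pin face: printed (1.18) `TermBound118` + print's slots + (G≈ℝ) -/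

open Classical in
/-- ★★★ **K3⁸ §2b's `hdec` FROM PRINTED (1.18) `TermBound118` + PRINTED (2.38) + PRINTED `AnalyticH` + (G≈ℝ)**, (1.21)-existence DISCHARGED ON THE CHART-FREE ROAD: p621851 §2
`kernelDecayOfRecord₁₃_of_termBound118_analyticH` with `hlim := polLimitsExistOfRecord₁₃_of_realTwoPoint …` (p620925 §5) at the tables `spj K (k+1)`: law + `TermBound118 (S K) (Window θ.γ)
(spj K) B κ_E` per torus + `Bound238` ∕ `AnalyticH` on the boxes + numerals + holomorphic readings with chart∕space clauses + tails + `lo` + probe radius + dials + (G≈ℝ) ⟹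
`KernelDecayOfRecord₁₃ F N θ μ ν κ′` at any `κ′ ≤ δ₁`.  LOCATED (hypothesis form); (D4) NOT discharged. -/
theorem kernelDecayOfRecord₁₃_of_termBound118_analyticH_realTwoPoint (θ : Stage13Params F N)
    {𝔸 : Type*} [NormedRing 𝔸] [NormedAlgebra ℂ 𝔸] (m' : ℕ) (M : ℕ) [NeZero M] (hM : M = F.L ^ m')
    (S : (K : ℕ) → ClusterTower (F.P K) 𝔸 M) (emb : ReadingMaps F (MatA N) 𝔸) (hloc : Localizes17OfRecord₁₃ F N θ S emb)
    (spj : (K j : ℕ) → (domSys (F.P K) M j).Dom → Set (CPair (F.P K) 𝔸))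
    {A R r₁ κ κE δ₀ B₃ r B κ' r₂ r₀ s : ℝ}
    (hA : 0 ≤ A) (hr₁ : 0 ≤ r₁) (hrate : r₁ + 2 * (64 * Real.log 162) + 2 ≤ R) (hsmall : A * Real.exp (5 * r₁ + 1) * K₀ 64 8 * 9 * 64 ≤ 1)
    (hκ0 : 0 < κ) (hκr : κ ≤ r₁) (hκ4 : kappa₀ (4 * 2 ^ 4) (2 * 4) ≤ κ / 2 / 2) (hδ₀ : 0 < δ₀) (hB₃ : 0 ≤ B₃) (hr : 0 < r) (hB : 0 ≤ B) (hκE : κ ≤ κE)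
    (hT : ∀ K : ℕ, TermBound118 (S K) (Window θ.γ) (spj K) B κE)
    (h238 : ∀ K k, ((S K) k).Bound238 (box θ.γ k) (spj K (k + 1)) A R) (hAn : ∀ K k, ((S K) k).AnalyticH (box θ.γ k) (spj K (k + 1)))
    (Ec : ℕ → ℕ → Type*) [∀ K k, NormedAddCommGroup (Ec K k)] [∀ K k, NormedSpace ℂ (Ec K k)]
    (ι : letI := θ.instVβ₁; letI := θ.instVβ₂
      (K k : ℕ) → (domSys (F.P K) M (k + 1)).Dom → ((Fin (F.P K).d → Site (F.P K) (k + 1) → θ.Vβ) →L[ℝ] Ec K k))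
    (Φ : (K k : ℕ) → (domSys (F.P K) M (k + 1)).Dom → Ec K k → CPair (F.P K) 𝔸)
    (U : (K k : ℕ) → (domSys (F.P K) M (k + 1)).Dom → Set (Ec K k)) (hU : ∀ K k X, IsOpen (U K k X)) (hrU : ∀ K k X, ball (0 : Ec K k) r ⊆ U K k X)
    (hΦhol : ∀ (K k : ℕ) (X : (domSys (F.P K) M (k + 1)).Dom), DifferentiableOn ℂ (Φ K k X) (U K k X))
    (hΦemb : letI := θ.instVβ₁; letI := θ.instVβ₂
      ∀ (K k : ℕ) (X : (domSys (F.P K) M (k + 1)).Dom) (Bp : Fin (F.P K).d → Site (F.P K) (k + 1) → θ.Vβ),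
        Φ K k X (ι K k X Bp) = emb K k (fun l t => NormedSpace.exp (θ.ρ8 (Bp l t))))
    (hΦsp : ∀ (K k : ℕ) (X : (domSys (F.P K) M (k + 1)).Dom), ∀ z ∈ U K k X, ∀ Z : (domSys (F.P K) M (k + 1)).Dom, Z.1 ⊆ X.1 → Φ K k X z ∈ spj K (k + 1) Z)
    (w : (K k : ℕ) → (domSys (F.P K) M (k + 1)).Dom → Site (F.P K) (k + 1) → ℝ) (hw₀ : ∀ K k X t, 0 ≤ w K k X t)
    (hw : letI := θ.instVβ₁; letI := θ.instVβ₂; letI := θ.instιβ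
      ∀ (K k : ℕ) (X : (domSys (F.P K) M (k + 1)).Dom) (l : Fin (F.P K).d) (t : Site (F.P K) (k + 1)) (c : θ.ιβ),
        ‖ι K k X (Pi.single l (Pi.single t (θ.bV c)))‖ ≤ w K k X t)
    (htail : ∀ (K k : ℕ) (X : (domSys (F.P K) M (k + 1)).Dom) (t : Site (F.P K) (k + 1)),
      let e : Site (F.P K) (k + 1) → TPt 4 (domCount (F.P K) M (k + 1) * M) := fun x i => (ZMod.cast (x i) : ZMod (domCount (F.P K) M (k + 1) * M))
      w K k X t ≤ B₃ * Real.exp (-δ₀ * distCT (domCount (F.P K) M (k + 1)) M (e t) (nearT (M := M) (e t) X)))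
    (lo : (k K : ℕ) → (domSys (F.P K) M (k + 1)).Dom → Prop) [∀ k K, DecidablePred (lo k K)]
    (hlo : ∀ (k K : ℕ) (X : (domSys (F.P K) M (k + 1)).Dom), ¬ lo k K X →
      let e : Site (F.P K) (k + 1) → TPt 4 (domCount (F.P K) M (k + 1) * M) := fun x i => (ZMod.cast (x i) : ZMod (domCount (F.P K) M (k + 1) * M))
      (K : ℝ) ≤ torusTreeLen X.1 ∨ (K : ℝ) ≤ distCT (domCount (F.P K) M (k + 1)) M (e (siteOfInt F K (k + 1) 0)) (nearT (M := M) (e (siteOfInt F K (k + 1) 0)) X))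
    (hr₂ : 0 < r₂) (hr₂r : (2 * B₃ + 1) * (2 * r₂) ≤ r) (hs0 : 0 < s) (hs1 : s < 1) (hr₀pos : 0 < r₀) (hr₀1 : r₀ ≤ 1)
    (hρ : (r₀ ^ (1 - s) * ((F.L : ℝ) ^ 4) ^ s) ^ (1 - s) * ((F.L : ℝ) ^ 4) ^ s < 1)
    (hGR : letI := θ.instVβ₁; letI := θ.instVβ₂; letI := θ.instιβ
      ∀ g ∈ Window θ.γ, ∀ (k : ℕ) (μ ν : Fin 4) (z : Fin 4 → ℤ), ∃ (K₀ : ℕ) (C : ℝ), ∀ K : ℕ, K₀ ≤ K → ∀ (c : θ.ιβ) (a b : ℝ), |a| ≤ r₂ → |b| ≤ r₂ →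
      ‖∑ X ∈ Finset.univ.filter (lo k (K + 1)), ((S (K + 1)) k).E (histPrefix g k) (emb (K + 1) k (fun l t => NormedSpace.exp (θ.ρ8
          ((a • (Pi.single (Fin.cast (F.P_d (K + 1)).symm μ) (Pi.single (siteOfInt F (K + 1) (k + 1) z) (θ.bV c)) : Fin (F.P (K + 1)).d → Site (F.P (K + 1)) (k + 1) → θ.Vβ) +
            b • (Pi.single (Fin.cast (F.P_d (K + 1)).symm ν) (Pi.single (siteOfInt F (K + 1) (k + 1) 0) (θ.bV c)) : Fin (F.P (K + 1)).d → Site (F.P (K + 1)) (k + 1) → θ.Vβ)) l t)))) X -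
        ∑ X ∈ Finset.univ.filter (lo k K), ((S K) k).E (histPrefix g k) (emb K k (fun l t => NormedSpace.exp (θ.ρ8
          ((a • (Pi.single (Fin.cast (F.P_d K).symm μ) (Pi.single (siteOfInt F K (k + 1) z) (θ.bV c)) : Fin (F.P K).d → Site (F.P K) (k + 1) → θ.Vβ) +
            b • (Pi.single (Fin.cast (F.P_d K).symm ν) (Pi.single (siteOfInt F K (k + 1) 0) (θ.bV c)) : Fin (F.P K).d → Site (F.P K) (k + 1) → θ.Vβ)) l t)))) X‖ ≤ C * r₀ ^ K)
    (hκ' : κ' ≤ delta1 δ₀ κ ((M : ℝ) * 4)) (μ ν : Fin 4) :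
    KernelDecayOfRecord₁₃ F N θ μ ν κ' :=
  kernelDecayOfRecord₁₃_of_termBound118 F N θ (polLimitsExistOfRecord₁₃_of_realTwoPoint F N θ m' hM S emb hloc (fun _ k => box θ.γ k) (fun _ hg _ k => histPrefix_mem_box hg k) (fun K k => spj K (k + 1)) hA hr₁ hκ0 hκr hκ4 hrate hsmall hB₃ hδ₀ hr h238 Ec ι Φ U hU hrU
      (fun K k _ hh X Z hZ => differentiableOn_H_comp_of_analyticH ((S K) k) (box θ.γ k) ((fun K k => spj K (k + 1)) K k) (hAn K k) hh (Φ K k X) (hΦhol K k X) X (hΦsp K k X) Z hZ)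
      hΦemb hΦsp w hw₀ hw htail lo hlo hr₂ hr₂r hs0 hs1 hr₀pos hr₀1 hρ hGR) m' M hM S emb hloc spj (kappa₀_le_half_of_le_quarter hκ0 hκ4) hδ₀ hB₃ hr hB hκE hT Ec ι Φ U hU hrU
    (differentiableOn_E_comp_of_printedSlots F S (fun K k => spj K (k + 1)) hA hr₁ hrate hsmall h238 hAn Ec Φ U hU hΦhol hΦsp)
    hΦemb (ball_mem_sp_of_spaceClause F (fun K k => spj K (k + 1)) Ec Φ U hrU hΦsp) w hw₀ hw htail hκ' μ ν

open Classical in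
/-- ★★★ **THE (D4) PIN FACE IN PRINT-LEVEL CURRENCY, (1.21) DISCHARGED FROM THE ACTIVITY SLOTS + (G≈ℝ)** — `ReadOutAt (datumOfRecord₁₃CoPH F N θ hP)
(rateCarriersOfRecord₁₃CoPH 𝔯 F θ hP g₀ os k).u3` for EVERY `k` under `hpin`, for a letter block with `ℓ.Signs`, `0 < ℓ.κ ≤ δ₁`, `β′₅.₁₀(4,1,ℓ.κ) ≤ ℓ.cr`: p621851 §2
`readOutAt_rateCarriers_of_kernels_pin_of_termBound118_analyticH` with `hlim := polLimitsExistOfRecord₁₃_of_realTwoPoint …`.  «W1-20's law + printed (1.18) + printed (2.38) + printed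
configuration analyticity + holomorphic minimizer readings + p. 282 tails + (G≈ℝ) + dials + numerals ⇒ the (D4) pin face at the pinned bundle, every run length»; (5.10) REDUCED by
dag-n27-w1, NOT discharged.  LOCATED (hypothesis form); (D4) NOT discharged. -/
theorem readOutAt_rateCarriers_of_kernels_pin_of_termBound118_analyticH_realTwoPoint (𝔯 : RateReading₁₃CoPH N) (θ : Stage13HParams F N) (hP : θ.Provisos₁₃CoPH F N)
    (g₀ : ℕ → ℝ) (os : List (ULoop F)) (ℓ : U3Letters₁₁) (hs : ℓ.Signs) (hℓ₀ : 0 < ℓ.κ) (hcr : betaPrime510 4 1 ℓ.κ ≤ ℓ.cr)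
    (hpin : (𝔯.lit F θ hP g₀ os).u3 = objectsOfRecord₁₃ F N θ.toStage13Params ℓ)
    {𝔸 : Type*} [NormedRing 𝔸] [NormedAlgebra ℂ 𝔸] (m' : ℕ) (M : ℕ) [NeZero M] (hM : M = F.L ^ m')
    (S : (K : ℕ) → ClusterTower (F.P K) 𝔸 M) (emb : ReadingMaps F (MatA N) 𝔸) (hloc : Localizes17OfRecord₁₃ F N θ.toStage13Params S emb)
    (spj : (K j : ℕ) → (domSys (F.P K) M j).Dom → Set (CPair (F.P K) 𝔸))
    {A R r₁ κ κE δ₀ B₃ r B r₂ r₀ s : ℝ}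
    (hA : 0 ≤ A) (hr₁ : 0 ≤ r₁) (hrate : r₁ + 2 * (64 * Real.log 162) + 2 ≤ R) (hsmall : A * Real.exp (5 * r₁ + 1) * K₀ 64 8 * 9 * 64 ≤ 1)
    (hκ0 : 0 < κ) (hκr : κ ≤ r₁) (hκ4 : kappa₀ (4 * 2 ^ 4) (2 * 4) ≤ κ / 2 / 2) (hδ₀ : 0 < δ₀) (hB₃ : 0 ≤ B₃) (hr : 0 < r) (hB : 0 ≤ B) (hκE : κ ≤ κE)
    (hT : ∀ K : ℕ, TermBound118 (S K) (Window θ.γ) (spj K) B κE)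
    (h238 : ∀ K k, ((S K) k).Bound238 (box θ.γ k) (spj K (k + 1)) A R) (hAn : ∀ K k, ((S K) k).AnalyticH (box θ.γ k) (spj K (k + 1)))
    (Ec : ℕ → ℕ → Type*) [∀ K k, NormedAddCommGroup (Ec K k)] [∀ K k, NormedSpace ℂ (Ec K k)]
    (ι : letI := θ.instVβ₁; letI := θ.instVβ₂
      (K k : ℕ) → (domSys (F.P K) M (k + 1)).Dom → ((Fin (F.P K).d → Site (F.P K) (k + 1) → θ.Vβ) →L[ℝ] Ec K k))
    (Φ : (K k : ℕ) → (domSys (F.P K) M (k + 1)).Dom → Ec K k → CPair (F.P K) 𝔸)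
    (U : (K k : ℕ) → (domSys (F.P K) M (k + 1)).Dom → Set (Ec K k)) (hU : ∀ K k X, IsOpen (U K k X)) (hrU : ∀ K k X, ball (0 : Ec K k) r ⊆ U K k X)
    (hΦhol : ∀ (K k : ℕ) (X : (domSys (F.P K) M (k + 1)).Dom), DifferentiableOn ℂ (Φ K k X) (U K k X))
    (hΦemb : letI := θ.instVβ₁; letI := θ.instVβ₂
      ∀ (K k : ℕ) (X : (domSys (F.P K) M (k + 1)).Dom) (Bp : Fin (F.P K).d → Site (F.P K) (k + 1) → θ.Vβ),
        Φ K k X (ι K k X Bp) = emb K k (fun l t => NormedSpace.exp (θ.ρ8 (Bp l t))))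
    (hΦsp : ∀ (K k : ℕ) (X : (domSys (F.P K) M (k + 1)).Dom), ∀ z ∈ U K k X, ∀ Z : (domSys (F.P K) M (k + 1)).Dom, Z.1 ⊆ X.1 → Φ K k X z ∈ spj K (k + 1) Z)
    (w : (K k : ℕ) → (domSys (F.P K) M (k + 1)).Dom → Site (F.P K) (k + 1) → ℝ) (hw₀ : ∀ K k X t, 0 ≤ w K k X t)
    (hw : letI := θ.instVβ₁; letI := θ.instVβ₂; letI := θ.instιβ
      ∀ (K k : ℕ) (X : (domSys (F.P K) M (k + 1)).Dom) (l : Fin (F.P K).d) (t : Site (F.P K) (k + 1)) (c : θ.ιβ),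
        ‖ι K k X (Pi.single l (Pi.single t (θ.bV c)))‖ ≤ w K k X t)
    (htail : ∀ (K k : ℕ) (X : (domSys (F.P K) M (k + 1)).Dom) (t : Site (F.P K) (k + 1)),
      let e : Site (F.P K) (k + 1) → TPt 4 (domCount (F.P K) M (k + 1) * M) := fun x i => (ZMod.cast (x i) : ZMod (domCount (F.P K) M (k + 1) * M))
      w K k X t ≤ B₃ * Real.exp (-δ₀ * distCT (domCount (F.P K) M (k + 1)) M (e t) (nearT (M := M) (e t) X)))
    (lo : (k K : ℕ) → (domSys (F.P K) M (k + 1)).Dom → Prop) [∀ k K, DecidablePred (lo k K)]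
    (hlo : ∀ (k K : ℕ) (X : (domSys (F.P K) M (k + 1)).Dom), ¬ lo k K X →
      let e : Site (F.P K) (k + 1) → TPt 4 (domCount (F.P K) M (k + 1) * M) := fun x i => (ZMod.cast (x i) : ZMod (domCount (F.P K) M (k + 1) * M))
      (K : ℝ) ≤ torusTreeLen X.1 ∨ (K : ℝ) ≤ distCT (domCount (F.P K) M (k + 1)) M (e (siteOfInt F K (k + 1) 0)) (nearT (M := M) (e (siteOfInt F K (k + 1) 0)) X))
    (hr₂ : 0 < r₂) (hr₂r : (2 * B₃ + 1) * (2 * r₂) ≤ r) (hs0 : 0 < s) (hs1 : s < 1) (hr₀pos : 0 < r₀) (hr₀1 : r₀ ≤ 1)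
    (hρ : (r₀ ^ (1 - s) * ((F.L : ℝ) ^ 4) ^ s) ^ (1 - s) * ((F.L : ℝ) ^ 4) ^ s < 1)
    (hGR : letI := θ.instVβ₁; letI := θ.instVβ₂; letI := θ.instιβ
      ∀ g ∈ Window θ.γ, ∀ (k : ℕ) (μ ν : Fin 4) (z : Fin 4 → ℤ), ∃ (K₀ : ℕ) (C : ℝ), ∀ K : ℕ, K₀ ≤ K → ∀ (c : θ.ιβ) (a b : ℝ), |a| ≤ r₂ → |b| ≤ r₂ →
      ‖∑ X ∈ Finset.univ.filter (lo k (K + 1)), ((S (K + 1)) k).E (histPrefix g k) (emb (K + 1) k (fun l t => NormedSpace.exp (θ.ρ8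
          ((a • (Pi.single (Fin.cast (F.P_d (K + 1)).symm μ) (Pi.single (siteOfInt F (K + 1) (k + 1) z) (θ.bV c)) : Fin (F.P (K + 1)).d → Site (F.P (K + 1)) (k + 1) → θ.Vβ) +
            b • (Pi.single (Fin.cast (F.P_d (K + 1)).symm ν) (Pi.single (siteOfInt F (K + 1) (k + 1) 0) (θ.bV c)) : Fin (F.P (K + 1)).d → Site (F.P (K + 1)) (k + 1) → θ.Vβ)) l t)))) X -
        ∑ X ∈ Finset.univ.filter (lo k K), ((S K) k).E (histPrefix g k) (emb K k (fun l t => NormedSpace.exp (θ.ρ8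
          ((a • (Pi.single (Fin.cast (F.P_d K).symm μ) (Pi.single (siteOfInt F K (k + 1) z) (θ.bV c)) : Fin (F.P K).d → Site (F.P K) (k + 1) → θ.Vβ) +
            b • (Pi.single (Fin.cast (F.P_d K).symm ν) (Pi.single (siteOfInt F K (k + 1) 0) (θ.bV c)) : Fin (F.P K).d → Site (F.P K) (k + 1) → θ.Vβ)) l t)))) X‖ ≤ C * r₀ ^ K)
    (hℓκ : ℓ.κ ≤ delta1 δ₀ κ ((M : ℝ) * 4)) (k : ℕ) :
    ReadOutAt (datumOfRecord₁₃CoPH F N θ hP) (rateCarriersOfRecord₁₃CoPH 𝔯 F θ hP g₀ os k).u3 :=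
  readOutAt_rateCarriers_of_kernels_pin_of_termBound118 F N 𝔯 θ hP g₀ os ℓ hs hℓ₀ hcr hpin (polLimitsExistOfRecord₁₃_of_realTwoPoint F N θ.toStage13Params m' hM S emb hloc (fun _ k => box θ.γ k) (fun _ hg _ k => histPrefix_mem_box hg k) (fun K k => spj K (k + 1)) hA hr₁ hκ0 hκr hκ4 hrate hsmall hB₃ hδ₀ hr h238 Ec ι Φ U hU hrU
      (fun K k _ hh X Z hZ => differentiableOn_H_comp_of_analyticH ((S K) k) (box θ.γ k) ((fun K k => spj K (k + 1)) K k) (hAn K k) hh (Φ K k X) (hΦhol K k X) X (hΦsp K k X) Z hZ)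
      hΦemb hΦsp w hw₀ hw htail lo hlo hr₂ hr₂r hs0 hs1 hr₀pos hr₀1 hρ hGR) m' M hM S emb hloc spj (kappa₀_le_half_of_le_quarter hκ0 hκ4) hδ₀ hB₃ hr hB hκE hT Ec ι Φ U hU hrU
    (differentiableOn_E_comp_of_printedSlots F S (fun K k => spj K (k + 1)) hA hr₁ hrate hsmall h238 hAn Ec Φ U hU hΦhol hΦsp)
    hΦemb (ball_mem_sp_of_spaceClause F (fun K k => spj K (k + 1)) Ec Φ U hrU hΦsp) w hw₀ hw htail hℓκ k

end YMDAG.N22.AtRecordOfPrintedSlots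

end
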